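import Mathlib.Topology.MetricSpace.Thickening
import Mathlib.Algebra.Polynomial.Roots
import Mathlib.Analysis.Complex.Basic
import Literature.Probability.LatticeModels.FKTwoArcPartitionPolynomials
import Literature.Probability.Percolation.BoxCrossingProofs
import Summits.CriticalPhenomena.CardyFormulaZ2.Theorems.CardyUSTContinuationUniformAnalyticExtensionStubRatioToCrux
import HarnessLib

/-!
# Partial results toward the stub `stub_zeroFreeNonCrossing` of the line `registered` (birth
# skeleton v6) for the crux `UniformAnalyticExtension` (stmt-CriticalPhenomena-6047)

The stub asks for a δ-UNIFORM complex zero-free neighbourhood of `[t₁, 1]` for the non-crossing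
polynomial `N^c_δ = Z_δ − N_δ` of the discretised conformal rectangle `Ω_δ` (stated as
`aeval z N_δ ≠ aeval z Z_δ`, `N_δ = fkTwoArcCrossingPolynomial R δ .joint`,
`Z_δ = fkTwoArcPartitionPolynomials R δ .joint`).  The δ-uniform statement (`∃ ρ` BEFORE `∀ᶠ δ`) is a
Lee–Yang statement at criticality, uniform in the volume, and is NOT proved here.  We record the
degenerate / per-δ content, which IS provable:

* `zeroFreeNonCrossing_empty_not_mem_arcCrossing`: with disjoint wired sets the empty configuration
  does not cross (a crossing needs an open path, and the open graph of `∅` is `⊥`);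
* `zeroFreeNonCrossing_aeval_lt`: for `δ > 0` with disjoint discrete arcs and real `t > 0`,
  `N_δ(t) < Z_δ(t)` (the empty configuration contributes `t^{2k(∅)} > 0` to `Z_δ − N_δ`);
* `zeroFreeNonCrossing_eventually_aeval_lt`, `zeroFreeNonCrossing_eventually_ne`: eventually as
  `δ → 0⁺` the discrete arcs are disjoint (`eventually_discreteArc_inter_eq_empty`), so
  `N_δ(t) < Z_δ(t)` on `(0, ∞)` and `N_δ ≠ Z_δ` (EVENTUAL NON-DEGENERACY: `N^c_δ ≢ 0`);
* `zeroFreeNonCrossing_pointwise`: the PER-δ zero-free statement (quantifiers `∀ᶠ δ, ∃ ρ`): for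
  all small `δ > 0` there is `ρ = ρ(δ) > 0` with `N_δ(z) ≠ Z_δ(z)` on the complex
  `ρ`-neighbourhood of `[t₁, 1]` (finitely many roots of `Z_δ − N_δ ∈ ℂ[X]`, none on the segment;
  the cast lemma `ratioToCrux_ofReal_aeval_natPoly` is reused from the landed `StubRatioToCrux`).
-/

noncomputable section

open Filter Topology Set Polynomial Metric
open Literature.Probability.LatticeModels
open Literature.Probability.RandomPlanarGeometry (ConformalRectangle)

namespace Summit.CriticalPhenomena.CardyFormulaZ2.Cruxes.UniformAnalyticExtension.Birth

/-- With disjoint wired sets `B₁, B₂` the empty configuration is not in the crossing event: its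
open graph is `⊥`, in which only trivial (length-0) paths exist. [folklore] -/
theorem zeroFreeNonCrossing_empty_not_mem_arcCrossing {V : Type*} {B₁ B₂ : Set V}
    (h : Disjoint B₁ B₂) :
    ((↑(∅ : Finset (Sym2 V)) : Literature.Probability.Percolation.BondConfig V)) ∉
      arcCrossing B₁ B₂ := by
  rintro ⟨x, hx, y, hy, hxy⟩
  simp only [Finset.coe_empty, Literature.Probability.Percolation.openGraph,
    SimpleGraph.fromEdgeSet_empty, SimpleGraph.reachable_bot] at hxy
  subst hxy
  exact h.ne_of_mem hx hy rfl

/-- Disjointness of the discrete arcs of `(ab)` and `(cd)` on the vertex type of `Ω_δ`, from the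
disjointness of the `Site 2`-valued discrete arcs. [folklore] -/
theorem zeroFreeNonCrossing_disjoint_rectArc (R : ConformalRectangle) {δ : ℝ}
    (hdisj : discreteArc R.carrier δ (R.arc 0) ∩ discreteArc R.carrier δ (R.arc 2) = ∅) :
    Disjoint (rectArc R δ 0) (rectArc R δ 2) := by
  rw [Set.disjoint_iff_inter_eq_empty, rectArc, rectArc, ← Set.preimage_inter, hdisj,
    Set.preimage_empty]

/-- **Real-axis strict inequality.** For `δ > 0` such that the discrete arcs of `(ab)` and `(cd)`
are disjoint and real `t > 0`: `N_δ(t) < Z_δ(t)`, i.e. the non-crossing polynomial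
`N^c_δ = Z_δ − N_δ` is positive on `(0, ∞)` (the empty configuration is non-crossing and
contributes `t^{2k(∅)} > 0`). [folklore] -/
theorem zeroFreeNonCrossing_aeval_lt (R : ConformalRectangle) {δ : ℝ} (hδ : 0 < δ)
    (hdisj : discreteArc R.carrier δ (R.arc 0) ∩ discreteArc R.carrier δ (R.arc 2) = ∅)
    {t : ℝ} (ht : 0 < t) :
    aeval t (fkTwoArcCrossingPolynomial R δ ArcWiring.joint) <
      aeval t (fkTwoArcPartitionPolynomials R δ ArcWiring.joint) := by
  classical
  letI : Fintype (meshDomain R.carrier δ) := (meshDomain_finite R.isBounded hδ).fintype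
  have hdA := zeroFreeNonCrossing_disjoint_rectArc R hdisj
  rw [fkTwoArcCrossingPolynomial_eq_rcArcPolynomialIn R hδ, fkTwoArcPartitionPolynomials_of_pos R hδ,
    aeval_rcArcPolynomialIn, aeval_rcArcPolynomial]
  refine Finset.sum_lt_sum_of_subset (Finset.filter_subset _ _) (i := ∅)
    (Finset.empty_mem_powerset _) ?_ (pow_pos ht _) (fun _ _ _ => (pow_pos ht _).le)
  rw [Finset.mem_filter, not_and]
  exact fun _ => zeroFreeNonCrossing_empty_not_mem_arcCrossing hdA

/-- **Eventually in `δ`, `N_δ < Z_δ` on the positive real axis**: for every conformal rectangle,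
for all small `δ > 0` and every real `t > 0`, `N_δ(t) < Z_δ(t)`. [folklore] -/
theorem zeroFreeNonCrossing_eventually_aeval_lt (R : ConformalRectangle) :
    ∀ᶠ δ in 𝓝[>] (0:ℝ), ∀ t : ℝ, 0 < t →
      aeval t (fkTwoArcCrossingPolynomial R δ ArcWiring.joint) <
        aeval t (fkTwoArcPartitionPolynomials R δ ArcWiring.joint) := by
  obtain ⟨δ₀, hδ₀, hdisj⟩ :=
    Literature.Probability.Percolation.eventually_discreteArc_inter_eq_empty R
  filter_upwards [Ioo_mem_nhdsGT hδ₀] with δ hδ t ht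
  exact zeroFreeNonCrossing_aeval_lt R hδ.1 (hdisj δ hδ.1 hδ.2) ht

/-- **Eventual non-degeneracy of the non-crossing polynomial**: for every conformal rectangle,
for all small `δ > 0` the crossing polynomial differs from the partition polynomial,
`N_δ ≠ Z_δ` (not every configuration crosses: `N^c_δ = Z_δ − N_δ ≢ 0`). [folklore] -/
theorem zeroFreeNonCrossing_eventually_ne (R : ConformalRectangle) :
    ∀ᶠ δ in 𝓝[>] (0:ℝ),
      fkTwoArcCrossingPolynomial R δ ArcWiring.joint ≠
        fkTwoArcPartitionPolynomials R δ ArcWiring.joint := by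
  filter_upwards [zeroFreeNonCrossing_eventually_aeval_lt R] with δ hδ hNZ
  exact (hδ 1 one_pos).ne (by rw [hNZ])

/-- **Per-δ zero-free neighbourhood** (the stub with the quantifiers `∃ ρ`, `∀ᶠ δ` swapped): for
every conformal rectangle `R` and `t₁ ∈ (0,1)`, for all small `δ > 0` there is `ρ = ρ(δ) > 0` such
that `N_δ(z) ≠ Z_δ(z)` on the complex `ρ`-neighbourhood of `[t₁, 1]`: the complex polynomial
`Z_δ − N_δ` is nonzero (positive at `t = 1`), so its root set is finite, closed and disjoint from
the compact segment (where `Z_δ − N_δ > 0`). [folklore] -/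
theorem zeroFreeNonCrossing_pointwise :
    ∀ R : ConformalRectangle, ∀ t₁ ∈ Set.Ioo (0:ℝ) 1, ∀ᶠ δ in 𝓝[>] (0:ℝ), ∃ ρ > (0:ℝ),
      ∀ z ∈ thickening ρ (((↑) : ℝ → ℂ) '' Set.Icc t₁ 1),
        aeval z (fkTwoArcCrossingPolynomial R δ ArcWiring.joint) ≠
          aeval z (fkTwoArcPartitionPolynomials R δ ArcWiring.joint) := by
  intro R t₁ ht₁
  filter_upwards [zeroFreeNonCrossing_eventually_aeval_lt R] with δ hδ
  set S : Set ℂ := ((↑) : ℝ → ℂ) '' Set.Icc t₁ 1 with hSdef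
  set N := fkTwoArcCrossingPolynomial R δ ArcWiring.joint with hNdef
  set Z := fkTwoArcPartitionPolynomials R δ ArcWiring.joint with hZdef
  set D : ℂ[X] := Z.map (algebraMap ℕ ℂ) - N.map (algebraMap ℕ ℂ) with hDdef
  have hD : ∀ z : ℂ, D.eval z = aeval z Z - aeval z N := fun z => by
    simp only [hDdef, eval_sub, eval_map, aeval_def]
  -- on the real positive axis `D > 0`
  have hDreal : ∀ t : ℝ, 0 < t → D.eval (t : ℂ) ≠ 0 := fun t ht h0 => by
    rw [hD, ← ratioToCrux_ofReal_aeval_natPoly, ← ratioToCrux_ofReal_aeval_natPoly,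
      ← Complex.ofReal_sub, Complex.ofReal_eq_zero] at h0
    have := hδ t ht
    linarith
  have hD0 : D ≠ 0 := fun h => hDreal 1 one_pos (by rw [h, eval_zero])
  -- the finite root set is closed and misses the compact segment
  have hF : {x : ℂ | D.IsRoot x}.Finite := finite_setOf_isRoot hD0
  have hSc : IsCompact S := isCompact_Icc.image Complex.continuous_ofReal
  have hdis : Disjoint S {x : ℂ | D.IsRoot x} := by
    rw [Set.disjoint_left]
    rintro _ ⟨t, ht, rfl⟩ hroot
    exact hDreal t (ht₁.1.trans_le ht.1) hroot
  obtain ⟨ρ, hρ, hρd⟩ := hdis.exists_thickenings hSc hF.isClosed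
  refine ⟨ρ, hρ, fun z hz hNZ => ?_⟩
  have hzF : z ∈ {x : ℂ | D.IsRoot x} := by
    show D.eval z = 0
    rw [hD, hNZ, sub_self]
  exact Set.disjoint_left.1 hρd hz (self_subset_thickening hρ _ hzF)

end Summit.CriticalPhenomena.CardyFormulaZ2.Cruxes.UniformAnalyticExtension.Birth
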